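import Mathlib

/-!
# Schur's lemma by the eigenvalue argument (admissible modules)

Blind cell `pub-hodge-repro2`, seat p8 (gen 5), Tier-5 kernel support.  The record
(route/T5-N3-route-2.md §N3.12.4 step (s3): «`End_{(𝔤,K)}(ρ) = ℂ` — an endomorphism preserves
each `K`-isotypic component, finite-dimensional by admissibility, has an eigenvalue `c` there, and
the kernel of `φ − c` is a non-zero submodule, hence everything») proves Schur's lemma for an
irreducible admissible `(𝔤,K)`-module by an EIGENVALUE argument, not by counting dimensions.
`T5DixmierSchur` (p391867) kernel-checked the counting route (Dixmier); this file kernel-checks the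
record's own route, which needs no countability:

  `M` a simple `A`-module over an algebraically closed field `k` (`A` a `k`-algebra); if `M` has
  a non-zero finite-dimensional `k`-subspace `W` stable under a given `A`-endomorphism `φ`, then
  `φ` is a scalar (`exists_smul_eq_of_stable`).  A subspace stable under EVERY endomorphism is
  `e • M` for an element `e` of `A` (the isotypic projector `e_τ` of a `K`-type `τ`, an element of
  the Hecke algebra `R(𝔤,K)`): if `e • M ≠ 0` is finite-dimensional then every `A`-endomorphism of
  `M` is a scalar (`exists_smul_eq_of_finiteDimensional_smul`), and the same with `e • M` replaced
  by the range of any `k`-linear map commuting with all endomorphisms.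

What stays prose: that the `K`-isotypic components of an admissible `(𝔤,K)`-module are
finite-dimensional and non-zero for some `τ`, and that they are cut out by elements of the acting
algebra (or, at least, are preserved by every `(𝔤,K)`-endomorphism) — the hypotheses below.

README §8(d): uses an L-value-free non-vanishing device: NO.
-/

namespace Summit.Ventures.HodgeRepro2.T5SchurEigenvalue

variable {k A M : Type*} [Field k] [Ring A] [Algebra k A] [AddCommGroup M] [Module A M]
  [Module k M] [IsScalarTower k A M]

/-- An `A`-endomorphism of `M` with a non-zero kernel on a simple module is zero. -/
theorem eq_zero_of_apply_eq_zero [IsSimpleModule A M] (ψ : Module.End A M) {w : M} (hw : w ≠ 0)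
    (hψ : ψ w = 0) : ψ = 0 := by
  rcases LinearMap.bijective_or_eq_zero ψ with hb | hz
  · exact absurd (hb.injective (hψ.trans (map_zero ψ).symm)) hw
  · exact hz

/-- **Schur by an eigenvalue.** If an `A`-endomorphism `φ` of a simple `A`-module `M` over an
algebraically closed field `k` preserves a non-zero finite-dimensional `k`-subspace `W`, then
`φ` is multiplication by a scalar. -/
theorem exists_smul_eq_of_stable [IsAlgClosed k] [IsSimpleModule A M] (φ : Module.End A M)
    (W : Submodule k M) (hW : W ≠ ⊥) [FiniteDimensional k W] (hstab : ∀ w ∈ W, φ w ∈ W) :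
    ∃ c : k, ∀ x, φ x = c • x := by
  -- the restriction of `φ` to `W`, as a `k`-linear endomorphism
  let φW : Module.End k W := (φ.restrictScalars k).restrict hstab
  have : Nontrivial W := Submodule.nontrivial_iff_ne_bot.mpr hW
  obtain ⟨c, hc⟩ := Module.End.exists_eigenvalue φW
  obtain ⟨w, hw⟩ := hc.exists_hasEigenvector
  have hw0 : (w : M) ≠ 0 := fun h => hw.2 (Subtype.ext h)
  have hwc : φ w = c • (w : M) := by
    have h1 := hw.apply_eq_smul
    have h2 := congrArg Subtype.val h1
    simpa [φW, LinearMap.restrict_apply] using h2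
  refine ⟨c, fun x => ?_⟩
  -- `φ - c` kills `w ≠ 0`, hence is zero
  have hzero : φ - algebraMap k (Module.End A M) c = 0 :=
    eq_zero_of_apply_eq_zero (φ - algebraMap k (Module.End A M) c) hw0
      (by rw [LinearMap.sub_apply, Module.algebraMap_end_apply, hwc, sub_self])
  have := congrArg (fun ψ : Module.End A M => ψ x) hzero
  simpa [sub_eq_zero] using this

/-- Multiplication by `e : A`, as a `k`-linear endomorphism of `M`. -/
def smulLeft (e : A) : M →ₗ[k] M where
  toFun m := e • m
  map_add' _ _ := smul_add _ _ _
  map_smul' c m := by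
    simp only [RingHom.id_apply]
    exact smul_comm e c m

/-- `smulLeft e m = e • m`. -/
@[simp] theorem smulLeft_apply (e : A) (m : M) : smulLeft (k := k) e m = e • m := rfl

/-- The subspace `e • M` is preserved by every `A`-endomorphism. -/
theorem range_smulLeft_stable (e : A) (φ : Module.End A M) :
    ∀ w ∈ LinearMap.range (smulLeft (k := k) (M := M) e), φ w ∈ LinearMap.range (smulLeft (k := k) (M := M) e) := by
  rintro w ⟨m, rfl⟩
  exact ⟨φ m, by rw [smulLeft_apply, smulLeft_apply, map_smul]⟩

/-- **Schur via a finite-dimensional `e • M`.** If some `e ∈ A` has `e • M ≠ 0` and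
finite-dimensional over `k` (an isotypic projector of an admissible module), then every
`A`-endomorphism of the simple module `M` is a scalar. -/
theorem exists_smul_eq_of_finiteDimensional_smul [IsAlgClosed k] [IsSimpleModule A M] (e : A)
    (hne : ∃ m : M, e • m ≠ 0)
    [FiniteDimensional k (LinearMap.range (smulLeft (k := k) (M := M) e))]
    (φ : Module.End A M) : ∃ c : k, ∀ x, φ x = c • x := by
  refine exists_smul_eq_of_stable φ (LinearMap.range (smulLeft (k := k) (M := M) e)) ?_
    (range_smulLeft_stable e φ)
  obtain ⟨m, hm⟩ := hne
  intro h
  have : e • m ∈ LinearMap.range (smulLeft (k := k) (M := M) e) := ⟨m, rfl⟩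
  rw [h, Submodule.mem_bot] at this
  exact hm this

/-- **Schur via a finite-dimensional commuting image.** If a `k`-linear endomorphism `p` of `M`
(a projector) commutes with every `A`-endomorphism and has non-zero finite-dimensional range, then
every `A`-endomorphism of the simple module `M` is a scalar. -/
theorem exists_smul_eq_of_finiteDimensional_range [IsAlgClosed k] [IsSimpleModule A M]
    (p : M →ₗ[k] M) (hp : ∀ φ : Module.End A M, ∀ m, φ (p m) = p (φ m))
    (hne : LinearMap.range p ≠ ⊥) [FiniteDimensional k (LinearMap.range p)]
    (φ : Module.End A M) : ∃ c : k, ∀ x, φ x = c • x :=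
  exists_smul_eq_of_stable φ (LinearMap.range p) hne
    (by rintro w ⟨m, rfl⟩; exact ⟨φ m, (hp φ m).symm⟩)

/-- The `ℂ` instance of `exists_smul_eq_of_finiteDimensional_smul`. -/
theorem exists_smul_eq_of_finiteDimensional_smul_complex {A M : Type*} [Ring A] [Algebra ℂ A]
    [AddCommGroup M] [Module A M] [Module ℂ M] [IsScalarTower ℂ A M] [IsSimpleModule A M] (e : A)
    (hne : ∃ m : M, e • m ≠ 0)
    [FiniteDimensional ℂ (LinearMap.range (smulLeft (k := ℂ) (M := M) e))]
    (φ : Module.End A M) : ∃ c : ℂ, ∀ x, φ x = c • x :=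
  exists_smul_eq_of_finiteDimensional_smul e hne φ

end Summit.Ventures.HodgeRepro2.T5SchurEigenvalue
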